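import Summits.RiemannHypothesis.RiemannHypothesis.Theorems.EvenSectorBartaEvenOneSignedWindowsAMPMargin
import HarnessLib

/-!
# The AMP margin is positive at a one-signed ground state (openness)

pub-rhpf PF seat (mechanism search; **no RH claim**).  Companion to `…AMPMargin`: the converse direction of
RULING A7's "per window, `t* > 0` ⟺ `u` one-signed-with-margin".  If the `u`-normalised pole-free resolvent family
is, near the level `ε₁`, given by a continuous curve `w` with `w ε₁ = u` (uniqueness + continuity packaged as the
hypothesis `huniq` — in finite dimension this is the resolvent `s ↦ -2p (A₀ - s)⁻¹ c` on `(E₀, E₁)`), the evaluations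
are finitely many and continuous (a grid), and `u` is one-signed above the floor `δ`, then `t* > 0`
(`ampMargin_pos_of_oneSigned`).  Elementary topology (a finite intersection of open sets), no spectral theory.
-/

set_option linter.unusedVariables false
set_option linter.dupNamespace false

namespace Summit.RiemannHypothesis.RiemannHypothesis.Theorems.PolarPerronFrobenius

variable {E : Type*} [AddCommGroup E] [Module ℝ E] [TopologicalSpace E] {ι : Type*} [Finite ι]

/-- OPENNESS: a one-signed ground state has positive AMP margin, provided the resolvent family through it is a
continuous curve of unique solutions near `ε₁` and the (finitely many) evaluations are continuous. -/
theorem ampMargin_pos_of_oneSigned (A₀ : E →ₗ[ℝ] E) (c : E) (ev : ι → E → ℝ) (δ p ε₁ E₁ : ℝ)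
    (h : ε₁ < E₁) {u : E} {w : ℝ → E} {η₀ : ℝ} (hη₀ : 0 < η₀)
    (hw : Continuous w) (hwu : w ε₁ = u) (hev : ∀ i, Continuous (ev i))
    (huniq : ∀ s, ε₁ ≤ s → s < ε₁ + η₀ → ∀ v : E, A₀ v - s • v = -((2 * p) • c) → v = w s)
    (hone : ∀ i, δ < ev i u) :
    0 < ampMargin A₀ c ev δ p ε₁ E₁ := by
  -- the set of levels at which the curve is one-signed above δ is open and contains ε₁
  set U : Set ℝ := ⋂ i, {s | δ < ev i (w s)} with hU
  have hUopen : IsOpen U := by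
    refine isOpen_iInter_of_finite (fun i => ?_)
    exact isOpen_lt continuous_const ((hev i).comp hw)
  have hmem : ε₁ ∈ U := by
    simp only [hU, Set.mem_iInter, Set.mem_setOf_eq, hwu]
    exact hone
  obtain ⟨r, hr, hball⟩ := Metric.isOpen_iff.mp hUopen ε₁ hmem
  -- choose η ≤ r, η ≤ η₀, η ≤ E₁ - ε₁
  set η : ℝ := min (min r η₀) (E₁ - ε₁) with hηdef
  have hηpos : 0 < η := lt_min (lt_min hr hη₀) (by linarith)
  have hηr : η ≤ r := le_trans (min_le_left _ _) (min_le_left _ _)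
  have hηη₀ : η ≤ η₀ := le_trans (min_le_left _ _) (min_le_right _ _)
  have hηE : ε₁ + η ≤ E₁ := by
    have := min_le_right (min r η₀) (E₁ - ε₁)
    linarith
  have hle := le_ampMargin_of_oneSigned_near A₀ c ev δ p ε₁ E₁ h hηE
    (fun s hs1 hs2 v hv => by
      have hsU : s ∈ U := by
        apply hball
        rw [Metric.mem_ball, Real.dist_eq, abs_lt]
        constructor <;> linarith
      have hvw : v = w s := huniq s hs1 (by linarith) v hv
      simp only [hU, Set.mem_iInter, Set.mem_setOf_eq] at hsU
      rw [hvw]; exact hsU)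
  exact lt_of_lt_of_le (div_pos hηpos (by linarith)) hle

/-- The two directions together (RULING A7, per window): under the same hypotheses,
`t* > 0 ↔ u` one-signed above `δ`. -/
theorem ampMargin_pos_iff_oneSigned (A₀ : E →ₗ[ℝ] E) (c : E) (ev : ι → E → ℝ) (δ p ε₁ E₁ : ℝ)
    (h : ε₁ < E₁) {u : E} {w : ℝ → E} {η₀ : ℝ} (hη₀ : 0 < η₀)
    (hw : Continuous w) (hwu : w ε₁ = u) (hev : ∀ i, Continuous (ev i))
    (huniq : ∀ s, ε₁ ≤ s → s < ε₁ + η₀ → ∀ v : E, A₀ v - s • v = -((2 * p) • c) → v = w s)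
    (hu : A₀ u - ε₁ • u = -((2 * p) • c)) :
    0 < ampMargin A₀ c ev δ p ε₁ E₁ ↔ ∀ i, δ < ev i u :=
  ⟨oneSigned_of_ampMargin_pos A₀ c ev δ p ε₁ E₁ h hu,
   ampMargin_pos_of_oneSigned A₀ c ev δ p ε₁ E₁ h hη₀ hw hwu hev huniq⟩

end Summit.RiemannHypothesis.RiemannHypothesis.Theorems.PolarPerronFrobenius
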